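import Summits.BirchSwinnertonDyer.BirchSwinnertonDyer.Theorems.CyclotomicUntwistFormalEndomorphismDigits
import Literature.NumberTheory.EllipticCurves.FormalGroupFrobeniusTypeProofs
import HarnessLib

/-!
# Route `CyclotomicUntwist`: endomorphisms of the reduced formal group — the INVERSE of an invertible
# endomorphism, the reduced VERSCHIEBUNG `V̄` (`[p]‾ = V̄(Xᵖ)`, `V̄'(0) = a_p`, `V̄ = [a_p] ⊖ π`), and the
# hypothesis (SS) «`π² ∈ [p]‾ ∘ End(F̄)`» ON ORDINARY FIBRES (`p ∤ a_p`: `e = V̄⁻¹(Xᵖ)`)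

Cell `pub/bsd-wall` (D-0145 line `route-BirchSwinnertonDyer-CyclotomicUntwist` rev 9), width seat
`bsd-line-cycu-p5` (gen 11), lane «ORDINARY FIBRES of the elementary Katz-rank route» (memo
`Cruxes/PSRankOneLowerHalfAtThree/KATZ-FROBENIUS-MOD-VARPI-v2.md` §2 (iv)). THEOREMS ONLY (no definition, no
named fact, no instance, no `sorry`); helper `--supports` K1 = stmt-BirchSwinnertonDyer-21580 (serves K2 = 21581
and the print child C2 = 27549 equally). BSD is not proved by this file and no crux or stub is.

CONTEXT. The registered stub S2k `stub_KATZ_rankLeTwo_supersingular` of `Lines/dfrob_wan.lean` (Katz 1981 Thm 5.3.3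
on SUPERSINGULAR fibres) is being closed by the elementary route W1 (Honda, cycu-p3) + ★ (digit expansion of
`End_{𝔽_p⟦X⟧}(F̄)`, cycu-p2, under the hypothesis (SS) «`∃ e ∈ End(F̄), [p]‾(e) = X^{p²}`») + the assembly
`PadicRankTwoAssembly.padicRankTwo_of_honda_of_endomorphisms` (cycu-p1, p638957) + the transport
`KatzRankBaseChange.katz_dieudonne_rank_le_two_of_padicRankTwo : H3 → katz_dieudonne_rank_le_two` (cycu-p4,
p637939), whose hypothesis `H3` is UNRESTRICTED (every good fibre). cycu-p2 discharges (SS) on supersingular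
fibres (`p ∣ a_p`: `e = [a_p/p]π ⊖ [1]`). THIS FILE discharges (SS) on ORDINARY fibres, so that the same chain
yields the Literature named fact `katz_dieudonne_rank_le_two` ITSELF (all good fibres), not only S2k.

CONTENT (every prime `p`; `E/𝔽_p` resp. `V/ℤ_p` with elliptic fibres, `Ē = V ⊗ 𝔽_p`, `F̄` its chord–tangent law;
"endomorphism" written out as in `CyclotomicUntwistFormalEndomorphismAlgebra`: `h(0) = 0`, `h(F̄) = F̄(h(X₀), h(X₁))`):
* §1 (any ring) `substInv_subst_subst` / `subst_substInv_subst` (`u⁻¹(u(Z)) = Z = u(u⁻¹(Z))` for Mathlib's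
  compositional inverse `PowerSeries.substInvOfIsUnit`), **`hom_substInv`** — the inverse of an endomorphism
  with unit linear term is an endomorphism;
* §2 (characteristic `p`) `pow_prime_eq_subst_X_pow` (`sᵖ = s(Xᵖ)` over `𝔽_p`), `expand_injective'`
  (`π = Xᵖ ∈ End(F̄)` is cycu-p2's `FormalEndomorphismDigits.hom_X_pow`, imported);
* §3 (reduction of `V/ℤ_p`, every prime `p`) the reduced Verschiebung `V̄ := formalMulFrobPart Ē p` (tree: `[p]‾ = V̄(Xᵖ)`,
  `formalMul_prime_eq_expand_of_charP`): **`hom_formalMulFrobPart`** (`V̄ ∈ End(F̄)`),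
  **`subst_pair_X_pow_formalMulFrobPart`** (`F̄(Xᵖ, V̄) = [a]‾`, i.e. `V̄ = [a]‾ ⊖ π`, from the tree's Frobenius
  identity `F̄(X^{p²}, [p]‾) = [a]‾(Xᵖ)`, all primes, `a = HasseManin.tr Ē`), **`coeff_one_formalMulFrobPart_eq`**
  (`V̄'(0) = a` in `𝔽_p`) and its corollary **`hasseCoeff_eq_intCast_tr`** (`p` odd: the Hasse invariant `A_p` of `Ē`
  is `a mod p` — Silverman AEC V.4.1(a) for curves lifted to `ℤ_p`, recorded as missing in
  `FormalGroupVerschiebungHasseZeroProofs`), `isUnit_coeff_one_formalMulFrobPart` (`p ∤ a ⟹ V̄'(0)` a unit);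
* §4 **`exists_hom_formalMul_subst_eq_X_pow_sq_of_not_dvd`** — (SS) ON ORDINARY FIBRES: if `p ∤ a` then `V̄` is
  invertible in `End(F̄)` and `e := V̄⁻¹(Xᵖ)` is an endomorphism with `[p]‾(e(X)) = X^{p²}`.

References: [cite: SilvermanAEC2009, IV.2.3, IV.4.4, IV.7 (proof of Thm. 7.4), V.4.1(a)] · [cite: Honda1970, §6.2, Thm. 9]
· [cite: Katz1981CrystallineDieudonne, §5.3 (context: rank of the Dieudonné module)].
-/

set_option autoImplicit false
-- single-conjunct summit: `Summit.BirchSwinnertonDyer.BirchSwinnertonDyer.…` repeats the name by design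
set_option linter.dupNamespace false

noncomputable section

open PowerSeries Literature.NumberTheory.EllipticCurves
  Summit.BirchSwinnertonDyer.BirchSwinnertonDyer.Theorems.FormalEndomorphismAlgebra
  Summit.BirchSwinnertonDyer.BirchSwinnertonDyer.Theorems.FormalEndomorphism
  Summit.BirchSwinnertonDyer.BirchSwinnertonDyer.Theorems.FormalEndomorphismDigits

namespace Summit.BirchSwinnertonDyer.BirchSwinnertonDyer.Theorems.FormalEndomorphismVerschiebung

/-! ## §1 The inverse of an invertible endomorphism (any commutative ring) -/

section AnyRing

variable {R : Type*} [CommRing R] (W : WeierstrassCurve R)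

omit W in
/-- `u⁻¹(u(Z)) = Z` for the compositional inverse `u⁻¹ = substInvOfIsUnit u` of a series `u = cX + ⋯`, `c` a unit.
[folklore] -/
theorem substInv_subst_subst {τ : Type*} {u : R⟦X⟧} (hu0 : constantCoeff u = 0) (hu1 : IsUnit (coeff 1 u))
    {Z : MvPowerSeries τ R} (hZ : MvPowerSeries.constantCoeff Z = 0) :
    (u.substInvOfIsUnit hu1).subst (u.subst Z) = Z := by
  rw [← subst_comp_subst_apply (HasSubst.of_constantCoeff_zero' hu0) (HasSubst.of_constantCoeff_zero hZ),
    subst_substInvOfIsUnit_left u hu0 hu1, subst_X (HasSubst.of_constantCoeff_zero hZ)]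

omit W in
/-- `u(u⁻¹(Z)) = Z`. [folklore] -/
theorem subst_substInv_subst {τ : Type*} {u : R⟦X⟧} (hu0 : constantCoeff u = 0) (hu1 : IsUnit (coeff 1 u))
    {Z : MvPowerSeries τ R} (hZ : MvPowerSeries.constantCoeff Z = 0) :
    u.subst ((u.substInvOfIsUnit hu1).subst Z) = Z := by
  rw [← subst_comp_subst_apply (HasSubst.substInvOfIsUnit u hu1) (HasSubst.of_constantCoeff_zero hZ),
    subst_substInvOfIsUnit_right u hu0 hu1, subst_X (HasSubst.of_constantCoeff_zero hZ)]

/-- **The inverse of an endomorphism with unit linear term is an endomorphism**: apply `u⁻¹` to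
`u(F(u⁻¹X₀, u⁻¹X₁)) = F(X₀, X₁)`. [cite: SilvermanAEC2009, IV.2.3] -/
theorem hom_substInv {u : R⟦X⟧} (hu0 : constantCoeff u = 0) (hu1 : IsUnit (coeff 1 u))
    (hu : u.subst W.formalGroupLaw =
      MvPowerSeries.subst ![u.subst (MvPowerSeries.X 0 : MvPowerSeries (Fin 2) R),
        u.subst (MvPowerSeries.X 1 : MvPowerSeries (Fin 2) R)] W.formalGroupLaw) :
    (u.substInvOfIsUnit hu1).subst W.formalGroupLaw =
      MvPowerSeries.subst ![(u.substInvOfIsUnit hu1).subst (MvPowerSeries.X 0 : MvPowerSeries (Fin 2) R),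
        (u.substInvOfIsUnit hu1).subst (MvPowerSeries.X 1 : MvPowerSeries (Fin 2) R)] W.formalGroupLaw := by
  set v := u.substInvOfIsUnit hu1 with hv
  have hv0 : constantCoeff v = 0 := constantCoeff_substInvOfIsUnit u hu1
  have hvi : ∀ i : Fin 2, MvPowerSeries.constantCoeff (v.subst (MvPowerSeries.X i : MvPowerSeries (Fin 2) R)) = 0 :=
    fun i => constantCoeff_subst_X hv0 i
  have key : u.subst (MvPowerSeries.subst ![v.subst (MvPowerSeries.X 0 : MvPowerSeries (Fin 2) R),
      v.subst (MvPowerSeries.X 1 : MvPowerSeries (Fin 2) R)] W.formalGroupLaw) = W.formalGroupLaw := by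
    rw [hom_subst_pair W hu0 hu (hvi 0) (hvi 1), subst_substInv_subst hu0 hu1 (MvPowerSeries.constantCoeff_X 0),
      subst_substInv_subst hu0 hu1 (MvPowerSeries.constantCoeff_X 1), subst_X_pair_self]
  have e : v.subst (u.subst (MvPowerSeries.subst ![v.subst (MvPowerSeries.X 0 : MvPowerSeries (Fin 2) R),
      v.subst (MvPowerSeries.X 1 : MvPowerSeries (Fin 2) R)] W.formalGroupLaw)) = v.subst W.formalGroupLaw := by
    rw [key]
  rw [substInv_subst_subst hu0 hu1 (constantCoeff_subst_pair W (hvi 0) (hvi 1))] at e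
  exact e.symm

/-- The linear term of the inverse is the inverse of the linear term: `u'(0) · (u⁻¹)'(0) = 1`. [folklore] -/
theorem coeff_one_mul_coeff_one_substInv {u : R⟦X⟧} (hu1 : IsUnit (coeff 1 u)) :
    coeff 1 u * coeff 1 (u.substInvOfIsUnit hu1) = 1 := by
  rw [coeff_one_substInvOfIsUnit, IsUnit.mul_val_inv]

end AnyRing

/-! ## §2 Characteristic `p`: Frobenius commutes with everything and is an endomorphism -/

section CharP

variable {p : ℕ} [hp : Fact p.Prime] (E : WeierstrassCurve (ZMod p))

omit E in
/-- `sᵖ = s(Xᵖ)` over `𝔽_p` (restated with `subst`). [folklore] -/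
theorem pow_prime_eq_subst_X_pow (s : (ZMod p)⟦X⟧) :
    s ^ p = s.subst ((PowerSeries.X : (ZMod p)⟦X⟧) ^ p) := by
  rw [Literature.RingTheory.FormalGroups.pow_prime_eq_expand_zmod, expand_apply]

omit hp E in
/-- `expand` is injective on one-variable series. [folklore] -/
theorem expand_injective' (hp0 : p ≠ 0) {f g : (ZMod p)⟦X⟧} (h : expand p hp0 f = expand p hp0 g) : f = g := by
  ext n
  have := congrArg (coeff (p * n)) h
  rwa [coeff_expand_mul, coeff_expand_mul] at this

end CharP

/-! ## §3 The reduced Verschiebung `V̄ = formalMulFrobPart Ē p` of a curve over `ℤ_p` -/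

section Verschiebung

variable {p : ℕ} [hp : Fact p.Prime] (V : WeierstrassCurve ℤ_[p]) [hE : (V.map PadicInt.Coe.ringHom).IsElliptic]
  [hEt : (V.map PadicInt.toZMod).IsElliptic]

omit hE hEt in
/-- `[p]‾ = V̄(Xᵖ)` for the reduction `Ē = V ⊗ 𝔽_p` (tree: `formalMul_prime_eq_expand_of_charP`), in `subst` form.
[cite: SilvermanAEC2009, IV.4.4] -/
theorem formalMul_prime_eq_subst :
    (V.map PadicInt.toZMod).formalMul p =
      ((V.map PadicInt.toZMod).formalMulFrobPart p).subst ((PowerSeries.X : (ZMod p)⟦X⟧) ^ p) := by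
  rw [WeierstrassCurve.formalMul_prime_eq_expand_of_charP p (V.map PadicInt.toZMod), expand_apply]

omit hE hEt in
/-- **`V̄` is an endomorphism of `F̄`.** `[p]‾` is an endomorphism with zero linear term, hence `= g(Xᵖ)` with `g`
an endomorphism (`FormalEndomorphism.exists_hom_expand_of_coeff_one_eq_zero`); `expand` is injective, so `g = V̄`.
[cite: SilvermanAEC2009, IV.4.4 and IV.7 (proof of Thm. 7.4)] -/
theorem hom_formalMulFrobPart :
    ((V.map PadicInt.toZMod).formalMulFrobPart p).subst (V.map PadicInt.toZMod).formalGroupLaw =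
      MvPowerSeries.subst
        ![((V.map PadicInt.toZMod).formalMulFrobPart p).subst (MvPowerSeries.X 0 : MvPowerSeries (Fin 2) (ZMod p)),
          ((V.map PadicInt.toZMod).formalMulFrobPart p).subst (MvPowerSeries.X 1 : MvPowerSeries (Fin 2) (ZMod p))]
        (V.map PadicInt.toZMod).formalGroupLaw := by
  set E := V.map PadicInt.toZMod with hEdef
  have hp0 : p ≠ 0 := hp.out.ne_zero
  have h1 : coeff 1 (E.formalMul p) = 0 := by
    rw [E.coeff_one_formalMul' p]; exact_mod_cast ZMod.natCast_self p
  obtain ⟨g, hg0, hg, hgh⟩ := exists_hom_expand_of_coeff_one_eq_zero E (E.constantCoeff_formalMul p)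
    (hom_formalMul E p) h1
  have e : g = E.formalMulFrobPart p := by
    refine expand_injective' hp0 ?_
    rw [← hg, WeierstrassCurve.formalMul_prime_eq_expand_of_charP p E]
  rw [← e]; exact hgh

/-- **`F̄(Xᵖ, V̄) = [a]‾`** (`a = HasseManin.tr Ē ≥ 0`): the tree's Frobenius identity `F̄(X^{p²}, [p]‾) = [a]‾(Xᵖ)`
is `(F̄(Xᵖ, V̄))(Xᵖ) = [a]‾(Xᵖ)`, and `expand` is injective. So `V̄ = [a]‾ ⊖ π` in `End(F̄)`.
[cite: SilvermanAEC2009, Thm. V.2.3.1(b) and IV.4.4] [cite: Honda1970, §6.2] -/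
theorem subst_pair_X_pow_formalMulFrobPart_of_nonneg
    (ha : 0 ≤ Literature.NumberTheory.EllipticCurves.HasseManin.tr (V.map PadicInt.toZMod)) :
    MvPowerSeries.subst ![(PowerSeries.X : (ZMod p)⟦X⟧) ^ p, (V.map PadicInt.toZMod).formalMulFrobPart p]
        (V.map PadicInt.toZMod).formalGroupLaw =
      (V.map PadicInt.toZMod).formalMul
        (Literature.NumberTheory.EllipticCurves.HasseManin.tr (V.map PadicInt.toZMod)).toNat := by
  set E := V.map PadicInt.toZMod with hEdef
  have hp0 : p ≠ 0 := hp.out.ne_zero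
  have hXp : constantCoeff ((PowerSeries.X : (ZMod p)⟦X⟧) ^ p) = 0 := WeierstrassCurve.constantCoeff_X_pow' hp0
  have hg0 : constantCoeff (E.formalMulFrobPart p) = 0 := E.constantCoeff_formalMulFrobPart p
  have hid := V.frobenius_formal_identity_of_nonneg' ha
  rw [← hEdef] at hid
  refine expand_injective' hp0 ?_
  rw [expand_apply, expand_apply, subst_pair_subst E hXp hg0 (HasSubst.X_pow hp0),
    subst_pow (HasSubst.X_pow hp0), subst_X (HasSubst.X_pow hp0), ← pow_mul, ← sq,
    ← formalMul_prime_eq_subst V, ← hid, X_subst]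

/-- The same for `a < 0`: `F̄(Xᵖ, V̄) = ī([|a|]‾)`. [cite: SilvermanAEC2009, Thm. V.2.3.1(b) and IV.4.4] -/
theorem subst_pair_X_pow_formalMulFrobPart_of_neg
    (ha : Literature.NumberTheory.EllipticCurves.HasseManin.tr (V.map PadicInt.toZMod) < 0) :
    MvPowerSeries.subst ![(PowerSeries.X : (ZMod p)⟦X⟧) ^ p, (V.map PadicInt.toZMod).formalMulFrobPart p]
        (V.map PadicInt.toZMod).formalGroupLaw =
      (V.map PadicInt.toZMod).formalNeg.subst ((V.map PadicInt.toZMod).formalMul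
        (Literature.NumberTheory.EllipticCurves.HasseManin.tr (V.map PadicInt.toZMod)).natAbs) := by
  set E := V.map PadicInt.toZMod with hEdef
  have hp0 : p ≠ 0 := hp.out.ne_zero
  have hXp : constantCoeff ((PowerSeries.X : (ZMod p)⟦X⟧) ^ p) = 0 := WeierstrassCurve.constantCoeff_X_pow' hp0
  have hg0 : constantCoeff (E.formalMulFrobPart p) = 0 := E.constantCoeff_formalMulFrobPart p
  have hm0 : constantCoeff (E.formalMul
      (Literature.NumberTheory.EllipticCurves.HasseManin.tr E).natAbs) = 0 := E.constantCoeff_formalMul _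
  have hid := V.frobenius_formal_identity_of_neg' ha
  rw [← hEdef] at hid
  refine expand_injective' hp0 ?_
  rw [expand_apply, expand_apply, subst_pair_subst E hXp hg0 (HasSubst.X_pow hp0),
    subst_pow (HasSubst.X_pow hp0), subst_X (HasSubst.X_pow hp0), ← pow_mul, ← sq,
    ← formalMul_prime_eq_subst V,
    subst_comp_subst_apply (HasSubst.of_constantCoeff_zero' hm0) (HasSubst.X_pow hp0), ← hid, X_subst]

/-- **`V̄'(0) = a` in `𝔽_p`** (`a = HasseManin.tr Ē`): compare linear terms in `F̄(Xᵖ, V̄) = [a]‾` (`p ≥ 3`, so `Xᵖ`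
has no linear term). [cite: SilvermanAEC2009, IV.4.4 and V.4.1(a)] -/
theorem coeff_one_formalMulFrobPart_eq :
    coeff 1 ((V.map PadicInt.toZMod).formalMulFrobPart p) =
      ((Literature.NumberTheory.EllipticCurves.HasseManin.tr (V.map PadicInt.toZMod) : ℤ) : ZMod p) := by
  set E := V.map PadicInt.toZMod with hEdef
  set a := Literature.NumberTheory.EllipticCurves.HasseManin.tr E with hadef
  have hp0 : p ≠ 0 := hp.out.ne_zero
  have hXp : constantCoeff ((PowerSeries.X : (ZMod p)⟦X⟧) ^ p) = 0 := WeierstrassCurve.constantCoeff_X_pow' hp0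
  have hg0 : constantCoeff (E.formalMulFrobPart p) = 0 := E.constantCoeff_formalMulFrobPart p
  have hX1 : coeff 1 ((PowerSeries.X : (ZMod p)⟦X⟧) ^ p) = 0 := by
    rw [coeff_X_pow, if_neg]; exact fun h => hp.out.one_lt.ne h
  have hlin : coeff 1 (MvPowerSeries.subst ![(PowerSeries.X : (ZMod p)⟦X⟧) ^ p, E.formalMulFrobPart p]
      E.formalGroupLaw) = coeff 1 (E.formalMulFrobPart p) := by
    rw [coeff_one_subst_pair E hXp hg0, hX1, zero_add]
  rcases le_or_gt 0 a with ha | ha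
  · rw [← hlin, hEdef, subst_pair_X_pow_formalMulFrobPart_of_nonneg V ha, ← hEdef,
      E.coeff_one_formalMul', ← hadef]
    rw [show ((a.toNat : ℕ) : ZMod p) = ((a.toNat : ℤ) : ZMod p) by rw [Int.cast_natCast], Int.toNat_of_nonneg ha]
  · rw [← hlin, hEdef, subst_pair_X_pow_formalMulFrobPart_of_neg V ha, ← hEdef,
      coeff_one_subst (E.constantCoeff_formalMul _), E.coeff_one_formalNeg, E.coeff_one_formalMul', ← hadef]
    rw [show ((a.natAbs : ℕ) : ZMod p) = ((|a| : ℤ) : ZMod p) by rw [← Int.natCast_natAbs, Int.cast_natCast],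
      abs_of_neg ha]
    push_cast; ring

/-- **Hasse invariant = trace of Frobenius mod `p`** for the reduction of `V/ℤ_p` (`p` odd): `A_p(Ē) = a mod p`
(`A_p = hasseCoeff`, Katz–Mazur 12.4.2: `V̄'(0) ≡ A_p`). [cite: SilvermanAEC2009, V.4.1(a) and IV.4.4] -/
theorem hasseCoeff_eq_intCast_tr (hp2 : p ≠ 2) :
    (V.map PadicInt.toZMod).hasseCoeff p =
      ((Literature.NumberTheory.EllipticCurves.HasseManin.tr (V.map PadicInt.toZMod) : ℤ) : ZMod p) := by
  have h := (V.map PadicInt.toZMod).coeff_one_formalMulFrobPart_sub_hasseCoeff_mem_span p hp2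
  rw [show Ideal.span {((p : ℕ) : ZMod p)} = ⊥ by rw [ZMod.natCast_self, Ideal.span_singleton_zero],
    Ideal.mem_bot, sub_eq_zero, coeff_one_formalMulFrobPart_eq V] at h
  exact h.symm

/-- **Ordinary ⟺ `V̄` invertible**: if `p ∤ a` the linear term of `V̄` is a unit of `𝔽_p`. [cite: SilvermanAEC2009, V.4.1(a)] -/
theorem isUnit_coeff_one_formalMulFrobPart
    (ha : ¬ (p : ℤ) ∣ Literature.NumberTheory.EllipticCurves.HasseManin.tr (V.map PadicInt.toZMod)) :
    IsUnit (coeff 1 ((V.map PadicInt.toZMod).formalMulFrobPart p)) := by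
  rw [coeff_one_formalMulFrobPart_eq V]
  refine Ne.isUnit ?_
  rwa [Ne, ZMod.intCast_zmod_eq_zero_iff_dvd]

/-! ## §4 (SS) on ordinary fibres: `e = V̄⁻¹(Xᵖ)` has `[p]‾(e) = X^{p²}` -/

/-- **(SS) ON ORDINARY FIBRES.** For `V/ℤ_p` (`p` odd) with elliptic fibres and `p ∤ a = HasseManin.tr Ē`, there is
an endomorphism `e` of the reduced formal group `F̄` with `[p]‾(e(X)) = X^{p²}` — namely `e = V̄⁻¹(Xᵖ)`, `V̄` the
reduced Verschiebung (invertible iff ordinary): `[p]‾(e) = V̄((V̄⁻¹(Xᵖ))ᵖ) = V̄(V̄⁻¹(X^{p²})) = X^{p²}`. This is the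
hypothesis (SS) «`π² ∈ [p]‾ ∘ End(F̄)`» of cycu-p2's digit expansion ★, which cycu-p2 discharges for `p ∣ a`;
together ★ holds on EVERY good fibre. [cite: SilvermanAEC2009, IV.4.4, IV.7.4 and V.4.1(a)] -/
theorem exists_hom_formalMul_subst_eq_X_pow_sq_of_not_dvd
    (ha : ¬ (p : ℤ) ∣ Literature.NumberTheory.EllipticCurves.HasseManin.tr (V.map PadicInt.toZMod)) :
    ∃ e : (ZMod p)⟦X⟧, constantCoeff e = 0 ∧
      e.subst (V.map PadicInt.toZMod).formalGroupLaw =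
        MvPowerSeries.subst ![e.subst (MvPowerSeries.X 0 : MvPowerSeries (Fin 2) (ZMod p)),
          e.subst (MvPowerSeries.X 1 : MvPowerSeries (Fin 2) (ZMod p))] (V.map PadicInt.toZMod).formalGroupLaw ∧
      ((V.map PadicInt.toZMod).formalMul p).subst e = (PowerSeries.X : (ZMod p)⟦X⟧) ^ p ^ 2 := by
  set E := V.map PadicInt.toZMod with hEdef
  have hp0 : p ≠ 0 := hp.out.ne_zero
  set Vb := E.formalMulFrobPart p with hVb
  have hVb0 : constantCoeff Vb = 0 := E.constantCoeff_formalMulFrobPart p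
  have hVb1 : IsUnit (coeff 1 Vb) := isUnit_coeff_one_formalMulFrobPart V ha
  set Vi := Vb.substInvOfIsUnit hVb1 with hVi
  have hVi0 : constantCoeff Vi = 0 := constantCoeff_substInvOfIsUnit Vb hVb1
  have hXp : constantCoeff ((PowerSeries.X : (ZMod p)⟦X⟧) ^ p) = 0 := WeierstrassCurve.constantCoeff_X_pow' hp0
  have hXp2 : constantCoeff ((PowerSeries.X : (ZMod p)⟦X⟧) ^ (p ^ 2)) = 0 := WeierstrassCurve.constantCoeff_X_pow' (pow_ne_zero 2 hp0)
  -- `e = Vi(Xᵖ)`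
  refine ⟨Vi.subst ((PowerSeries.X : (ZMod p)⟦X⟧) ^ p), constantCoeff_subst_eq_zero hXp _ hVi0, ?_, ?_⟩
  · -- `e = Vi ∘ π` is a composite of endomorphisms
    exact hom_comp E hVi0 (hom_substInv E hVb0 hVb1 (hom_formalMulFrobPart V)) hXp (hom_X_pow E)
  · -- `[p]‾(e) = V̄(eᵖ) = V̄(Vi(X^{p²})) = X^{p²}`
    have he0 : constantCoeff (Vi.subst ((PowerSeries.X : (ZMod p)⟦X⟧) ^ p)) = 0 := constantCoeff_subst_eq_zero hXp _ hVi0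
    have hes : HasSubst (Vi.subst ((PowerSeries.X : (ZMod p)⟦X⟧) ^ p)) := HasSubst.of_constantCoeff_zero' he0
    rw [hEdef, formalMul_prime_eq_subst V, ← hEdef, ← hVb,
      subst_comp_subst_apply (HasSubst.X_pow hp0) hes, subst_pow hes, subst_X hes,
      pow_prime_eq_subst_X_pow, subst_comp_subst_apply (HasSubst.X_pow hp0) (HasSubst.X_pow hp0),
      subst_pow (HasSubst.X_pow hp0), subst_X (HasSubst.X_pow hp0), ← pow_mul, ← sq,
      subst_substInv_subst hVb0 hVb1 hXp2]

end Verschiebung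

end Summit.BirchSwinnertonDyer.BirchSwinnertonDyer.Theorems.FormalEndomorphismVerschiebung

end
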